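import Summits.HodgeConjecture.HodgeConjecture.Theses.So7OddThetaNulls

/-!
# `¬ OddThetaNulls` — KERNEL-checked refutation of crux stmt-HodgeConjecture-18788 (no `native_decide`)

For `(a,b) = (30,248) ∈ chars` and `Hce = (116,-36,-144,-48,-32,32)`:
`bucket 30 Hce = {m₁, m₂}`, `bucket 30 (flipQ Hce) = {n₁, n₂}`, all four term signs `-1`, hence
`thetaCoeff 30 248 Hce = thetaCoeff 30 248 (flipQ Hce) = -2`, contradicting oddness (`-2 ≠ -(-2)`).

Kernel strategy (the box `box 30 116` has 163 296 indices — too many for a direct `decide`): from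
`quadVec (charVec 30 m) = Hce` the two DEFINITE combinations `(Q₀+Q₁)/16 = m₀² + (2m₃+1)² + 4m₅² + 4m₆² = 5` and
`(Q₀−Q₁)/8 = (2m₁+1)² + (2m₂+1)² + (2m₄+1)² + 16m₇² = 19` bound every coordinate (`nlinarith`), placing `m` in an
explicit box of `5·4·4·2·4·3·3·3 = 17 280` candidates; a `decide +kernel` sieve guarded by the two cheap equations
(only `480` survivors reach the evaluation of `quadVec`) pins the bucket down to the two known indices.

`lean check --json --axioms …not_OddThetaNulls`: rc 0, wall ≈ 110 s, sorries 0,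
axioms `[propext, Classical.choice, Quot.sound]` (2026-08-17, planner-skel-stmt-HodgeConjecture-18788-0).

TO LAND (refuter / disprover — planners do not propose proofs): copy this file to
`Summits/HodgeConjecture/HodgeConjecture/Theorems/So7OddThetaNullsOddThetaNullsRefutation.lean`, change the
namespace to `Summit.HodgeConjecture.HodgeConjecture.Theorems.So7OddThetaNulls` (and the main theorem to
`not_oddThetaNulls` if the naming lint asks), then
`ledger propose --kind refutation --target Summits/HodgeConjecture/HodgeConjecture/Theorems/So7OddThetaNullsOddThetaNullsRefutation.lean
 --file … --workitem stmt-HodgeConjecture-18788 --note "misstated: 8 of the 24 chars ((a,b+128), a<128) are not odd in z₅; repaired: restrict to the 16 of oddChars (COUNTEREXAMPLE.md §5)"`.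
Class `refuted-misstated`; repaired statement `C′ = OddThetaNullsR` (16 characteristics) in `COUNTEREXAMPLE.md` §5 of this
directory, with a checked 2-stub skeleton. Once landed, replace THIS workfile by a pointer (`crux write --force`) so the
tree does not elaborate the sieve twice.
-/

namespace Summit.HodgeConjecture.HodgeConjecture.Cruxes.OddThetaNulls.RefutationKernel

open Literature.NumberTheory.ModularForms.So7KugaSatake
open Summit.HodgeConjecture.HodgeConjecture.Theses.So7OddThetaNulls

/-- The violating exponent. [folklore] -/
def Hce : Fin 6 → ℤ := ![116, -36, -144, -48, -32, 32]

/-- `y = 2m₁ + a = (0,1,-1,1,-1,0,2,2)`. [folklore] -/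
def m₁ : Fin 8 → ℤ := ![0, 0, -1, 0, -1, 0, 1, 1]

/-- `y = 2m₂ + a = (0,-1,1,-1,1,0,-2,-2)`. [folklore] -/
def m₂ : Fin 8 → ℤ := ![0, -1, 0, -1, 0, 0, -1, -1]

/-- `y = 2n₁ + a = (4,3,3,-1,1,0,0,0)`. [folklore] -/
def n₁ : Fin 8 → ℤ := ![2, 1, 1, -1, 0, 0, 0, 0]

/-- `y = 2n₂ + a = (-4,-3,-3,1,-1,0,0,0)`. [folklore] -/
def n₂ : Fin 8 → ℤ := ![-2, -2, -2, 0, -1, 0, 0, 0]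

theorem m₁_ne_m₂ : m₁ ≠ m₂ := by decide

theorem n₁_ne_n₂ : n₁ ≠ n₂ := by decide

theorem mem_chars_30_248 : ((30, 248) : ℕ × ℕ) ∈ chars := by decide

/-- All four term signs for `b = 248` are `-1`. [folklore] -/
theorem signs : termSign 248 m₁ = -1 ∧ termSign 248 m₂ = -1 ∧ termSign 248 n₁ = -1 ∧ termSign 248 n₂ = -1 := by
  decide

/-! ### Symbolic form of `Q₀, Q₁` on the coset `30 + 2ℤ⁸` -/

theorem bitVec_30 : bitVec 30 = ![0, 1, 1, 1, 1, 0, 0, 0] := by decide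

set_option maxHeartbeats 800000 in
/-- `Q₀(2m + a)`, `a = 30`, as a polynomial in `m`. [folklore] -/
theorem q0_coset (m : Fin 8 → ℤ) : quadVec (charVec 30 m) 0 =
    8 * m 0 ^ 2 + 16 * m 1 ^ 2 + 16 * m 1 + 16 * m 2 ^ 2 + 16 * m 2 + 32 * m 3 ^ 2 + 32 * m 3 +
      16 * m 4 ^ 2 + 16 * m 4 + 32 * m 5 ^ 2 + 32 * m 6 ^ 2 + 64 * m 7 ^ 2 + 20 := by
  simp [quadVec, charVec, bitVec_30, gram, Matrix.mulVec, dotProduct, Fin.sum_univ_eight, nsmul_eq_mul]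
  ring

set_option maxHeartbeats 800000 in
/-- `Q₁(2m + a)`, `a = 30`, as a polynomial in `m`. [folklore] -/
theorem q1_coset (m : Fin 8 → ℤ) : quadVec (charVec 30 m) 1 =
    8 * m 0 ^ 2 - 16 * m 1 ^ 2 - 16 * m 1 - 16 * m 2 ^ 2 - 16 * m 2 + 32 * m 3 ^ 2 + 32 * m 3 -
      16 * m 4 ^ 2 - 16 * m 4 + 32 * m 5 ^ 2 + 32 * m 6 ^ 2 - 64 * m 7 ^ 2 - 4 := by
  simp [quadVec, charVec, bitVec_30, gram, Matrix.mulVec, dotProduct, Fin.sum_univ_eight, nsmul_eq_mul]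
  ring

/-- `(Q₀ + Q₁)/16` on the coset, as a polynomial in `m`. [folklore] -/
def E1 (v : Fin 8 → ℤ) : ℤ := v 0 ^ 2 + (2 * v 3 + 1) ^ 2 + 4 * v 5 ^ 2 + 4 * v 6 ^ 2

/-- `(Q₀ − Q₁)/8` on the coset, as a polynomial in `m`. [folklore] -/
def E2 (v : Fin 8 → ℤ) : ℤ := (2 * v 1 + 1) ^ 2 + (2 * v 2 + 1) ^ 2 + (2 * v 4 + 1) ^ 2 + 16 * v 7 ^ 2

/-- The reduced candidate box (17 280 indices). [folklore] -/
def Tbox : Fin 8 → Finset ℤ :=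
  ![{-2, -1, 0, 1, 2}, {-2, -1, 0, 1}, {-2, -1, 0, 1}, {-1, 0}, {-2, -1, 0, 1}, {-1, 0, 1}, {-1, 0, 1}, {-1, 0, 1}]

/-- From the shell equations `Q₀ = 116`, `Q₁ = -36` on the coset: the two definite equations and the box. [folklore] -/
theorem reduce (m : Fin 8 → ℤ) (h0 : quadVec (charVec 30 m) 0 = 116) (h1 : quadVec (charVec 30 m) 1 = -36) :
    E1 m = 5 ∧ E2 m = 19 ∧ m ∈ Fintype.piFinset Tbox := by
  rw [q0_coset] at h0
  rw [q1_coset] at h1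
  have e1' : 16 * E1 m = 80 := by unfold E1; linear_combination h0 + h1
  have e2' : 8 * E2 m = 152 := by unfold E2; linear_combination h0 - h1
  have e1 : E1 m = 5 := by omega
  have e2 : E2 m = 19 := by omega
  refine ⟨e1, e2, ?_⟩
  clear h0 h1 e1' e2'
  unfold E1 at e1
  unfold E2 at e2
  have s0 : m 0 ^ 2 ≤ 5 := by nlinarith [sq_nonneg (2 * m 3 + 1), sq_nonneg (m 5), sq_nonneg (m 6)]
  have s3 : (2 * m 3 + 1) ^ 2 ≤ 5 := by nlinarith [sq_nonneg (m 0), sq_nonneg (m 5), sq_nonneg (m 6)]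
  have s5 : 4 * m 5 ^ 2 ≤ 5 := by nlinarith [sq_nonneg (m 0), sq_nonneg (2 * m 3 + 1), sq_nonneg (m 6)]
  have s6 : 4 * m 6 ^ 2 ≤ 5 := by nlinarith [sq_nonneg (m 0), sq_nonneg (2 * m 3 + 1), sq_nonneg (m 5)]
  have s1 : (2 * m 1 + 1) ^ 2 ≤ 19 := by nlinarith [sq_nonneg (2 * m 2 + 1), sq_nonneg (2 * m 4 + 1), sq_nonneg (m 7)]
  have s2 : (2 * m 2 + 1) ^ 2 ≤ 19 := by nlinarith [sq_nonneg (2 * m 1 + 1), sq_nonneg (2 * m 4 + 1), sq_nonneg (m 7)]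
  have s4 : (2 * m 4 + 1) ^ 2 ≤ 19 := by nlinarith [sq_nonneg (2 * m 1 + 1), sq_nonneg (2 * m 2 + 1), sq_nonneg (m 7)]
  have s7 : 16 * m 7 ^ 2 ≤ 19 := by nlinarith [sq_nonneg (2 * m 1 + 1), sq_nonneg (2 * m 2 + 1), sq_nonneg (2 * m 4 + 1)]
  clear e1 e2
  have a0 : m 0 ≤ 2 := by nlinarith [sq_nonneg (m 0 + 3)]
  have b0 : -2 ≤ m 0 := by nlinarith [sq_nonneg (m 0 - 3)]
  have a3 : m 3 ≤ 0 := by nlinarith [sq_nonneg (m 3 + 1)]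
  have b3 : -1 ≤ m 3 := by nlinarith [sq_nonneg (m 3)]
  have a5 : m 5 ≤ 1 := by nlinarith [sq_nonneg (m 5 + 2)]
  have b5 : -1 ≤ m 5 := by nlinarith [sq_nonneg (m 5 - 2)]
  have a6 : m 6 ≤ 1 := by nlinarith [sq_nonneg (m 6 + 2)]
  have b6 : -1 ≤ m 6 := by nlinarith [sq_nonneg (m 6 - 2)]
  have a1 : m 1 ≤ 1 := by nlinarith [sq_nonneg (m 1 + 2)]
  have b1 : -2 ≤ m 1 := by nlinarith [sq_nonneg (m 1 - 2)]
  have a2 : m 2 ≤ 1 := by nlinarith [sq_nonneg (m 2 + 2)]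
  have b2 : -2 ≤ m 2 := by nlinarith [sq_nonneg (m 2 - 2)]
  have a4 : m 4 ≤ 1 := by nlinarith [sq_nonneg (m 4 + 2)]
  have b4 : -2 ≤ m 4 := by nlinarith [sq_nonneg (m 4 - 2)]
  have a7 : m 7 ≤ 1 := by nlinarith [sq_nonneg (m 7 + 2)]
  have b7 : -1 ≤ m 7 := by nlinarith [sq_nonneg (m 7 - 2)]
  rw [Fintype.mem_piFinset]
  intro i
  fin_cases i <;> simp [Tbox] <;> omega

set_option maxRecDepth 100000 in
/-- The guarded sieve for `Hce` (kernel `decide`; only the `E1 ∧ E2` survivors evaluate `quadVec`). [folklore] -/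
theorem sieve : ∀ v ∈ Fintype.piFinset Tbox, E1 v = 5 → E2 v = 19 →
    quadVec (charVec 30 v) = Hce → v = m₁ ∨ v = m₂ := by
  decide +kernel

set_option maxRecDepth 100000 in
/-- The guarded sieve for `flipQ Hce`. [folklore] -/
theorem sieve_flip : ∀ v ∈ Fintype.piFinset Tbox, E1 v = 5 → E2 v = 19 →
    quadVec (charVec 30 v) = flipQ Hce → v = n₁ ∨ v = n₂ := by
  decide +kernel

theorem bucket_subset : bucket 30 Hce ⊆ {m₁, m₂} := by
  intro m hm
  rw [bucket, Finset.mem_filter] at hm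
  obtain ⟨-, hq⟩ := hm
  have h0 : quadVec (charVec 30 m) 0 = 116 := by rw [hq]; decide
  have h1 : quadVec (charVec 30 m) 1 = -36 := by rw [hq]; decide
  obtain ⟨e1, e2, hT⟩ := reduce m h0 h1
  have := sieve m hT e1 e2 hq
  simpa using this

theorem bucket_flip_subset : bucket 30 (flipQ Hce) ⊆ {n₁, n₂} := by
  intro m hm
  rw [bucket, Finset.mem_filter] at hm
  obtain ⟨-, hq⟩ := hm
  have h0 : quadVec (charVec 30 m) 0 = 116 := by rw [hq]; decide
  have h1 : quadVec (charVec 30 m) 1 = -36 := by rw [hq]; decide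
  obtain ⟨e1, e2, hT⟩ := reduce m h0 h1
  have := sieve_flip m hT e1 e2 hq
  simpa using this

theorem card_bucket_le : (bucket 30 Hce).card ≤ 2 :=
  (Finset.card_le_card bucket_subset).trans (by rw [Finset.card_pair m₁_ne_m₂])

theorem card_bucket_flip_le : (bucket 30 (flipQ Hce)).card ≤ 2 :=
  (Finset.card_le_card bucket_flip_subset).trans (by rw [Finset.card_pair n₁_ne_n₂])

/-! ### Memberships, bucket determination, coefficient values -/

theorem m₁_mem : m₁ ∈ bucket 30 Hce := by
  simp only [bucket, Finset.mem_filter, box, Fintype.mem_piFinset]; decide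

theorem m₂_mem : m₂ ∈ bucket 30 Hce := by
  simp only [bucket, Finset.mem_filter, box, Fintype.mem_piFinset]; decide

theorem n₁_mem : n₁ ∈ bucket 30 (flipQ Hce) := by
  simp only [bucket, Finset.mem_filter, box, Fintype.mem_piFinset, flipQ_zero]; decide

theorem n₂_mem : n₂ ∈ bucket 30 (flipQ Hce) := by
  simp only [bucket, Finset.mem_filter, box, Fintype.mem_piFinset, flipQ_zero]; decide

theorem bucket_eq : bucket 30 Hce = {m₁, m₂} :=
  Finset.Subset.antisymm bucket_subset
    (Finset.insert_subset_iff.mpr ⟨m₁_mem, Finset.singleton_subset_iff.mpr m₂_mem⟩)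

theorem bucket_flip_eq : bucket 30 (flipQ Hce) = {n₁, n₂} :=
  Finset.Subset.antisymm bucket_flip_subset
    (Finset.insert_subset_iff.mpr ⟨n₁_mem, Finset.singleton_subset_iff.mpr n₂_mem⟩)

/-- `thetaCoeff 30 248 (116,-36,-144,-48,-32,32) = -2` (kernel). [folklore] -/
theorem coeff_eq : thetaCoeff 30 248 Hce = -2 := by
  simp only [thetaCoeff, bucket_eq, Finset.sum_pair m₁_ne_m₂, signs.1, signs.2.1]
  norm_num

/-- `thetaCoeff 30 248 (116,-36,-144,-48,-32,-32) = -2` (kernel). [folklore] -/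
theorem coeff_flip_eq : thetaCoeff 30 248 (flipQ Hce) = -2 := by
  simp only [thetaCoeff, bucket_flip_eq, Finset.sum_pair n₁_ne_n₂, signs.2.2.1, signs.2.2.2]
  norm_num

/-- **Refutation of the crux** `OddThetaNulls` (route `So7OddThetaNulls`, item stmt-HodgeConjecture-18788): the
characteristic `(30,248) ∈ chars` is not odd in `z₅`. Kernel-checked; no `native_decide`. [folklore] -/
theorem not_OddThetaNulls : ¬ OddThetaNulls := by
  intro h
  have e := h (30, 248) mem_chars_30_248 Hce
  rw [coeff_flip_eq, coeff_eq] at e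
  norm_num at e

end Summit.HodgeConjecture.HodgeConjecture.Cruxes.OddThetaNulls.RefutationKernel
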